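import Summits.BirchSwinnertonDyer.BirchSwinnertonDyer.Theorems.KimAtThreeDeepUpperKolyvaginStableThree
import HarnessLib

/-!
# THEOREM D-u at TWO depths with (COMP) at ANY `3`-torsion of `E(ℚ₃)`: the place `3` paid by deeper
# derivative families of depth `+ N₀`, `N₀` a `3`-power torsion-stabilisation level of `E(ℚ₃)`
# (cell `bsd-addord`, seat `bsd-addord-w2-acc3` gen 4, PROGRAMME PART 1b plan g16 ACCEL-LIST (3); route W2
# `KimAtThreeKolyvagin`, crux 19679 `DeepLowerAtThreeOffKatoStratum`, stub `stub_additiveDefect`, its `t ≥ 1` rows)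

HONEST FRAMING: TOOL theorem (no definition, no named fact, no `sorry`); closes nothing by itself;
nothing is booked; BSD is not proved by any of this.  `--supports` stmt-BirchSwinnertonDyer-19679 (the item
OWNER assembles).

## What, and why

Seat w2-c3 gen 5's THEOREM D-u PAIR
(`KimAtThreeDeepUpperKolyvaginPair.exists_isKolyvaginSystem_pair_propagatedSelmerStructure_of_unramified`,
p471148: ONE Euler system of `T₃E`, TWO depths `k ≤ m`, ONE generator family `σ`, the Kolyvagin systems for
`𝓕_can` at both depths and (COMP)) carries the place `3` as the displayed binders `htop`/`htop″`
(`𝓕_can(E[3^{k+1}])₃ = ⊤`, i.e. `E(ℚ₃)[3] = 0`, Mazur–Rubin Lemma A.1) — this is why every consumer of the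
two-exponent chain (★★-u `KimAtThreeTwoExponentWitnessPairU`, ★₂-u, PORT₂ on the additive-defect rows) is
restricted to the `t = 0` rows, and why the `t ≥ 1` additive rows of crux 19679 were DISPLAYED as the residual
line (R₁) (this seat gen 3, `KimAtThreeOffStratumAdditiveDefectOfFineKato`).  Seat w2-c3 gen 6's
`KimAtThreeDeepUpperKolyvaginStableThree` removed `htop` from the ONE-depth THEOREM D-u by Mazur–Rubin's
depth-raising (App. A Prop. A.2, "`H¹_𝓕(ℚ_p, T/𝔪^k T)` is the image of `H¹(ℚ_p, T/𝔪^j T)` for all sufficiently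
large `j`", with `j = k + N₀` EXPLICIT, `N₀` a torsion-stabilisation level: `3^{N₀+1}·P = 0 → 3^{N₀}·P = 0` on
`E(ℚ₃)`; n1011-p13's T-DER-BP FILE 2 `localization_map_red_mem_propagatedSelmerStructure_three`).
**This file is the PAIR form of that theorem**: the Pair theorem's statement with `htop`/`htop″` REPLACED by
`hstab` (level `N₀`) and the Kolyvagin primes of `D` / `D″` taken of level `3^{k+N₀+1}` / `3^{m+N₀+1}`; the
place `3` at output depth `k` (resp. `m`) is paid by StableThree §1 on this file's own deeper derivative family
of depth `k + N₀` (resp. `m + N₀`) for the SAME `σ`; every bad `w ≠ 3` by THEOREM B-u (`hur` = ZetaBody's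
(C2)); (COMP) by n1011's `map_derivativeFamily_eq`.  Conclusion identical to the Pair theorem's, token for
token.  With `N₀ = 0` (`E(ℚ₃)[3] = 0`) it is the Pair theorem; on an additive row `N₀ = 2` always holds
(`hstab_two_of_hasAdditiveReductionAt`), and `N₀ = t` holds on every row with `#E(ℚ₃)[3^∞] = 3^t` — so the
With-guard depth `k + t` of PORT₂ supplies exactly the level `k + t + 1` this theorem asks for (sequel files
★★-stable / ★₂-stable of this seat).

HONEST LIMITS: `p = 3`; no Euler system asserted (`c`, `hc`, `hur` displayed); values not here; closes nothing.
Credit: seat w2-c3 gen 5/6 (D-u Pair, StableThree), cell `b2b-bsdres` team n1011 (D7, T-DER-BP, B-u); this seat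
only merges the two.

References: B. Mazur, K. Rubin, Mem. AMS 799 (2004), Def. 3.2.1, Thm. 3.2.4, App. A Prop. A.2 (pp. 79–80) and
Remark A.5; K. Rubin, *Euler Systems* (2000) Def. 4.4.4, Lemma 4.4.2, Thm. 4.5.1, 4.5.4; K. Kato, Astérisque 295
(2004) (8.1.3), §8.2, Lemma 8.5; C.-H. Kim, arXiv:2203.12159, Thm. 3.13, §2.2.2; cell memo kim3/KIM3-PROOF.md §14.3 (1a).
-/

noncomputable section

-- the cell's Theorems namespace `Summit.BirchSwinnertonDyer.BirchSwinnertonDyer.…` repeats the summit name by design (D-0017)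
set_option linter.dupNamespace false

open CategoryTheory Function Finset Polynomial Field IsDedekindDomain NumberField
open scoped NumberField Classical ContRepresentation
open Literature.NumberTheory.GaloisRepresentations Literature.NumberTheory.EllipticCurves
open Literature.NumberTheory.GaloisRepresentations.DiscreteGaloisModule
open Literature.NumberTheory.GaloisCohomology
open Summit.BirchSwinnertonDyer.Rank1Residual.GaloisImage
open Summit.BirchSwinnertonDyer.Rank1Residual.GaloisImage.CoeffTransport
open Summit.BirchSwinnertonDyer.Rank1Residual.GaloisImage.CyclotomicLevel
open Summit.BirchSwinnertonDyer.Rank1Residual.GaloisImage.TorsionCoeff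
open Summit.BirchSwinnertonDyer.Rank1Residual.GaloisImage.Derivative
open Summit.BirchSwinnertonDyer.Rank1Residual.GaloisImage.Derivative.Rat
open Summit.BirchSwinnertonDyer.BirchSwinnertonDyer.Theorems.KimAtThreeDeepUpperBadPlaceClause
open Summit.BirchSwinnertonDyer.BirchSwinnertonDyer.Theorems.KimAtThreeDeepUpperKolyvaginStableThree
open Rat.HeightOneSpectrum WeierstrassCurve TateModule

namespace Summit.BirchSwinnertonDyer.BirchSwinnertonDyer.Theorems.KimAtThreeDeepLowerKolyvaginPairStable

variable (W : WeierstrassCurve ℚ) [W.IsElliptic] [W.IsGloballyMinimal]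
variable [Module.Free ℤ_[3] (W.tateModule 3)] [Module.Finite ℤ_[3] (W.tateModule 3)]
  [ContinuousSMul ℤ_[3] (W.tateModule 3)]

/-- Local notation: `T∞ = T₃ E` as a continuous `G_ℚ`-representation. -/
local notation3 "T∞" => WeierstrassCurve.tateGaloisRep W 3 (W.continuous_galoisRepTate_holds 3)

/-- Local notation: `𝐫⟦f, T′, U⟧ = f_* : H¹(U, T₃E) → H¹(U, T′)`. -/
local notation3 (prettyPrint := false) "𝐫⟦" f ", " Tg ", " U "⟧" =>
  ContinuousCohomology.map (ContinuousMonoidHom.id _)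
    (X := subgroupRep (ContinuousRep.toTopRep T∞) U)
    (Y := subgroupRep (ContinuousRep.toTopRep Tg) U)
    ((TopRep.resFunctor (Subgroup.subtype U)).map f) 1

variable (S : Set (HeightOneSpectrum (𝓞 ℚ)))

/-- Local notation: `𝓛` = the cyclotomic Euler-system levels `ℚ(μ_{3^{n+1}}, μ_r)`, `r ∩ S = ∅`. -/
local notation3 "𝓛" => cyclotomicLevelsRat 3 S

/-- Local notation: `𝐃⟦A, X, U, τ⟧ ℓ = ∑_{j < ℓ−1} j·(τ_ℓ)_*^j`, Kolyvagin's derivative operator. -/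
local notation3 (prettyPrint := false) "𝐃⟦" A ", " X ", " U ", " τ "⟧" =>
  fun ℓ : HeightOneSpectrum (𝓞 ℚ) =>
  ∑ j ∈ Finset.range (((primesEquiv ℓ : Nat.Primes) : ℕ) - 1),
    (j : Module.End A (continuousCohomology 1 (subgroupRep X U))) *
      (conjMap X U ((τ : HeightOneSpectrum (𝓞 ℚ) → absoluteGaloisGroup ℚ) ℓ) 1).hom.toLinearMap ^ j

/-- Local notation: the level-`j` reduction `red_j : T₃E ⟶ E[3^j]_{ℤ₃}` (GZ-2) — the coefficient systems of the
two AUXILIARY deeper families. -/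
local notation3 "𝐫𝐞𝐝⟦" j "⟧" => tateModuleRed W 3 (W.continuous_galoisRepTate_holds 3) j

/-- **THEOREM D-u at TWO depths with (COMP), at ANY `3`-torsion of `E(ℚ₃)`** (rows WITH anomalous bad places
allowed, NO thinning of the Kolyvagin primes; `p = 3`): every binder of seat w2-c3's
`KimAtThreeDeepUpperKolyvaginPair.exists_isKolyvaginSystem_pair_propagatedSelmerStructure_of_unramified` with
`htop`/`htop″` (`𝓕_can,3 = ⊤`, i.e. `E(ℚ₃)[3] = 0`) REPLACED by the torsion-stabilisation binder `hstab` of level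
`N₀` at the place(s) over `3` (`3^{N₀+1}·P = 0 → 3^{N₀}·P = 0` on `E(ℚ_v)`) and the Kolyvagin primes of `D` / `D″`
taken of level `3^{k+N₀+1}` / `3^{m+N₀+1}`.  Conclusion identical to the Pair theorem's: ONE `σ`, transports `Φ_r`,
`Φ″_r`, the two families with `D.IsKolyvaginSystem (𝓕_can,k) κ`, `D″.IsKolyvaginSystem (𝓕_can,m) κ″`, the derivative
characterisations, and `π_* (κ″ d) = κ d` on the common levels.  The place `3` at each output depth is paid by
StableThree §1 (`localization_mem_propagatedSelmerStructure_three_of_res_eq_deriv_of_stable`: THE derivative class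
of depth `3^{k+1}` is the reduction of the depth-`3^{k+N₀+1}` one for the same `σ`, and every reduction from depth
`≥ k + N₀` lands in `𝓕_can` — Mazur–Rubin Prop. A.2 with the depth explicit) on this file's own auxiliary families
of depths `k + N₀`, `m + N₀` (coefficients `E[3^{·+1}]_{ℤ₃}`, GZ-2); every bad `w ≠ 3` by THEOREM B-u (`hur`);
(COMP) by `map_derivativeFamily_eq`.
[cite: MazurRubin2004, Def. 3.2.1, Thm. 3.2.4, App. A Prop. A.2 (pp. 79–80) and Remark A.5 (p. 81)]
[cite: Rubin2000, Def. 4.4.4, Lemma 4.4.2, Thm. 4.5.1] [cite: Rubin2011, §3.1 (p. 29)]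
[cite: Kato2004Asterisque, (8.1.3) (p. 180) and Lemma 8.5] [cite: Kim2022StructureSelmer, Thm. 3.13 and §2.2.2] -/
theorem exists_isKolyvaginSystem_pair_propagatedSelmerStructure_of_stable_of_unramified {k m N₀ : ℕ}
    (hkm : k ≤ m)
    {c : ∀ (i : ℕ) (r : (𝓛).Ideals), H1 T∞ ((𝓛).level i r.1)}
    (hc : IsEulerSystem 𝓛 T∞ 3 c)
    -- depth `k`
    {M' : Type} [AddCommGroup M'] [Module ℤ_[3] M'] [TopologicalSpace M'] [DiscreteTopology M']
    [IsTopologicalAddGroup M'] [ContinuousSMul ℤ_[3] M'] {T' : GaloisRep ℚ ℤ_[3] M'}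
    (red : T∞.toTopRep ⟶ T'.toTopRep) (hred : Function.Surjective red.hom)
    (hM : ∀ x : M', (((3 : ℕ) : ℤ_[3]) ^ (k + 1)) • x = 0)
    (e : M' →+ WeierstrassCurve.geomTorsion W (((3 : ℕ) : ℤ) ^ k * ((3 : ℕ) : ℤ))) (hec : Continuous e)
    (he : ∀ (g : absoluteGaloisGroup ℚ) (x : M'),
      e (T'.toTopRep.ρ g x) = (W.torsionGaloisModule (((3 : ℕ) : ℤ) ^ k * ((3 : ℕ) : ℤ))).toTopRep.ρ g (e x))
    (einv : WeierstrassCurve.geomTorsion W (((3 : ℕ) : ℤ) ^ k * ((3 : ℕ) : ℤ)) →+ M') (hic : Continuous einv)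
    (h₁ : ∀ x, einv (e x) = x) (h₂ : ∀ y, e (einv y) = y)
    (hcomp : ∀ a : W.tateModule 3,
      ((e (red.hom a) : geomTorsion W (((3 : ℕ) : ℤ) ^ k * ((3 : ℕ) : ℤ))) : geomPoints W) = proj 3 (k + 1) a)
    -- depth `m`
    {M'' : Type} [AddCommGroup M''] [Module ℤ_[3] M''] [TopologicalSpace M''] [DiscreteTopology M'']
    [IsTopologicalAddGroup M''] [ContinuousSMul ℤ_[3] M''] {T'' : GaloisRep ℚ ℤ_[3] M''}
    (red'' : T∞.toTopRep ⟶ T''.toTopRep) (hred'' : Function.Surjective red''.hom)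
    (hM'' : ∀ x : M'', (((3 : ℕ) : ℤ_[3]) ^ (m + 1)) • x = 0)
    (e'' : M'' →+ WeierstrassCurve.geomTorsion W (((3 : ℕ) : ℤ) ^ m * ((3 : ℕ) : ℤ))) (hec'' : Continuous e'')
    (he'' : ∀ (g : absoluteGaloisGroup ℚ) (x : M''),
      e'' (T''.toTopRep.ρ g x) = (W.torsionGaloisModule (((3 : ℕ) : ℤ) ^ m * ((3 : ℕ) : ℤ))).toTopRep.ρ g (e'' x))
    (einv'' : WeierstrassCurve.geomTorsion W (((3 : ℕ) : ℤ) ^ m * ((3 : ℕ) : ℤ)) →+ M'') (hic'' : Continuous einv'')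
    (h₁'' : ∀ x, einv'' (e'' x) = x) (h₂'' : ∀ y, e'' (einv'' y) = y)
    (hcomp'' : ∀ a : W.tateModule 3,
      ((e'' (red''.hom a) : geomTorsion W (((3 : ℕ) : ℤ) ^ m * ((3 : ℕ) : ℤ))) : geomPoints W) = proj 3 (m + 1) a)
    (π : (W.torsionGaloisModule (((3 : ℕ) : ℤ) ^ m * ((3 : ℕ) : ℤ))).toContRepresentation →ⁱL
      (W.torsionGaloisModule (((3 : ℕ) : ℤ) ^ k * ((3 : ℕ) : ℤ))).toContRepresentation)
    (hπ : ∀ x : geomTorsion W (((3 : ℕ) : ℤ) ^ m * ((3 : ℕ) : ℤ)),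
      ((π x : geomTorsion W (((3 : ℕ) : ℤ) ^ k * ((3 : ℕ) : ℤ))) : geomPoints W) =
        (((3 : ℕ) : ℤ) ^ (m - k)) • (x : geomPoints W))
    -- the curve, the torsion-stabilisation level at the place(s) over `3`, and the two datums (same `η`)
    (hirr : W.HasIrreducibleModPGaloisRep 3)
    (hstab : ∀ v : HeightOneSpectrum (𝓞 ℚ), ((primesEquiv v : Nat.Primes) : ℕ) = 3 →
      ∀ P : (W.baseChange (v.adicCompletion ℚ)).toAffine.Point, 3 ^ (N₀ + 1) • P = 0 → 3 ^ N₀ • P = 0)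
    (D : KolyvaginDatum (W.torsionGaloisModule (((3 : ℕ) : ℤ) ^ k * ((3 : ℕ) : ℤ))))
    (hT : D.transverse = cyclotomicTransverse (W.torsionGaloisModule (((3 : ℕ) : ℤ) ^ k * ((3 : ℕ) : ℤ))))
    (D'' : KolyvaginDatum (W.torsionGaloisModule (((3 : ℕ) : ℤ) ^ m * ((3 : ℕ) : ℤ))))
    (hT'' : D''.transverse = cyclotomicTransverse (W.torsionGaloisModule (((3 : ℕ) : ℤ) ^ m * ((3 : ℕ) : ℤ))))
    {η : (ℓ : HeightOneSpectrum (𝓞 ℚ)) → (ZMod (Ideal.absNorm ℓ.asIdeal))ˣ}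
    (hD : D.HasCanonicalComparison (3 ^ (k + 1)) η) (hD'' : D''.HasCanonicalComparison (3 ^ (m + 1)) η)
    (hPr : D.primes ⊆ (𝓛).primes) (hPr'' : D''.primes ⊆ (𝓛).primes)
    (hKol : ∀ ℓ ∈ D.primes, Kato.IsKolyvaginPrime W 3 (k + N₀ + 1) ((primesEquiv ℓ : Nat.Primes) : ℕ))
    (hKol'' : ∀ ℓ ∈ D''.primes, Kato.IsKolyvaginPrime W 3 (m + N₀ + 1) ((primesEquiv ℓ : Nat.Primes) : ℕ))
    -- (C2): every class of the Euler system is UNRAMIFIED AWAY FROM `3` at class level (`ZetaBody` (C2))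
    (hur : ∀ (i : ℕ) (r : (𝓛).Ideals) (v : HeightOneSpectrum (𝓞 ℚ)), ((primesEquiv v : Nat.Primes) : ℕ) ≠ 3 →
      ∀ 𝔓 ∈ v.primesAbove,
        resLe (T∞).toTopRep
          (inf_le_left : (𝓛).level i r.1 ⊓ 𝔓.inertia (absoluteGaloisGroup ℚ) ≤ (𝓛).level i r.1) 1 (c i r) = 0) :
    ∃ (σ : HeightOneSpectrum (𝓞 ℚ) → absoluteGaloisGroup ℚ)
      (Φ : ∀ r : Finset (HeightOneSpectrum (𝓞 ℚ)),
        continuousCohomology 1 (subgroupRep T'.toTopRep ((𝓛).level ⊥ r)) →+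
          continuousCohomology 1 (subgroupRep
            (W.torsionGaloisModule (((3 : ℕ) : ℤ) ^ k * ((3 : ℕ) : ℤ))).toTopRep ((𝓛).level ⊥ r)))
      (comm : ∀ r : Finset (HeightOneSpectrum (𝓞 ℚ)),
        ((r : Finset _) : Set (HeightOneSpectrum (𝓞 ℚ))).Pairwise fun a b =>
          Commute (𝐃⟦ℤ, (W.torsionGaloisModule (((3 : ℕ) : ℤ) ^ k * ((3 : ℕ) : ℤ))).toTopRep, ((𝓛).level ⊥ r), σ⟧ a)
            (𝐃⟦ℤ, (W.torsionGaloisModule (((3 : ℕ) : ℤ) ^ k * ((3 : ℕ) : ℤ))).toTopRep, ((𝓛).level ⊥ r), σ⟧ b))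
      (κ : Finset (HeightOneSpectrum (𝓞 ℚ)) → galoisCohomology (W.torsionGaloisModule (((3 : ℕ) : ℤ) ^ k * ((3 : ℕ) : ℤ))) 1)
      (Φ'' : ∀ r : Finset (HeightOneSpectrum (𝓞 ℚ)),
        continuousCohomology 1 (subgroupRep T''.toTopRep ((𝓛).level ⊥ r)) →+
          continuousCohomology 1 (subgroupRep
            (W.torsionGaloisModule (((3 : ℕ) : ℤ) ^ m * ((3 : ℕ) : ℤ))).toTopRep ((𝓛).level ⊥ r)))
      (comm'' : ∀ r : Finset (HeightOneSpectrum (𝓞 ℚ)),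
        ((r : Finset _) : Set (HeightOneSpectrum (𝓞 ℚ))).Pairwise fun a b =>
          Commute (𝐃⟦ℤ, (W.torsionGaloisModule (((3 : ℕ) : ℤ) ^ m * ((3 : ℕ) : ℤ))).toTopRep, ((𝓛).level ⊥ r), σ⟧ a)
            (𝐃⟦ℤ, (W.torsionGaloisModule (((3 : ℕ) : ℤ) ^ m * ((3 : ℕ) : ℤ))).toTopRep, ((𝓛).level ⊥ r), σ⟧ b))
      (κ'' : Finset (HeightOneSpectrum (𝓞 ℚ)) →
        galoisCohomology (W.torsionGaloisModule (((3 : ℕ) : ℤ) ^ m * ((3 : ℕ) : ℤ))) 1),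
      (∀ ℓ, σ ℓ ∈ (adicCompletionPrime ℚ ℓ).inertia (absoluteGaloisGroup ℚ)) ∧
      (∀ ℓ, modNCyclotomicCharacter ℚ (Ideal.absNorm ℓ.asIdeal) (σ ℓ) = η ℓ) ∧
      (∀ r, ∀ (φ : contOneCocycles (subgroupRep T'.toTopRep ((𝓛).level ⊥ r)))
        (ψ : contOneCocycles (subgroupRep
          (W.torsionGaloisModule (((3 : ℕ) : ℤ) ^ k * ((3 : ℕ) : ℤ))).toTopRep ((𝓛).level ⊥ r))),
        (∀ g, ψ.1 g = e (φ.1 g)) → Φ r (oneCocycleClass _ φ) = oneCocycleClass _ ψ) ∧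
      (∀ r, ∀ (φ : contOneCocycles (subgroupRep T''.toTopRep ((𝓛).level ⊥ r)))
        (ψ : contOneCocycles (subgroupRep
          (W.torsionGaloisModule (((3 : ℕ) : ℤ) ^ m * ((3 : ℕ) : ℤ))).toTopRep ((𝓛).level ⊥ r))),
        (∀ g, ψ.1 g = e'' (φ.1 g)) → Φ'' r (oneCocycleClass _ φ) = oneCocycleClass _ ψ) ∧
      D.IsKolyvaginSystem (propagatedSelmerStructure W 3 k) κ ∧
      D''.IsKolyvaginSystem (propagatedSelmerStructure W 3 m) κ'' ∧
      (∀ r : Finset (HeightOneSpectrum (𝓞 ℚ)), ¬ (↑r : Set _) ⊆ D.primes → κ r = 0) ∧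
      (∀ r : Finset (HeightOneSpectrum (𝓞 ℚ)), ¬ (↑r : Set _) ⊆ D''.primes → κ'' r = 0) ∧
      (∀ (r : Finset (HeightOneSpectrum (𝓞 ℚ))) (hr : (↑r : Set _) ⊆ D.primes),
        resSubgroup (W.torsionGaloisModule (((3 : ℕ) : ℤ) ^ k * ((3 : ℕ) : ℤ))).toTopRep ((𝓛).level ⊥ r) 1 (κ r) =
          (r.noncommProd 𝐃⟦ℤ, (W.torsionGaloisModule (((3 : ℕ) : ℤ) ^ k * ((3 : ℕ) : ℤ))).toTopRep, ((𝓛).level ⊥ r), σ⟧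
            (comm r)) (Φ r (𝐫⟦red, T', ((𝓛).level ⊥ r)⟧
              (c ⊥ ⟨r, fun _ hq => hPr (hr (Finset.mem_coe.2 hq))⟩)))) ∧
      (∀ (r : Finset (HeightOneSpectrum (𝓞 ℚ))) (hr : (↑r : Set _) ⊆ D''.primes),
        resSubgroup (W.torsionGaloisModule (((3 : ℕ) : ℤ) ^ m * ((3 : ℕ) : ℤ))).toTopRep ((𝓛).level ⊥ r) 1 (κ'' r) =
          (r.noncommProd 𝐃⟦ℤ, (W.torsionGaloisModule (((3 : ℕ) : ℤ) ^ m * ((3 : ℕ) : ℤ))).toTopRep, ((𝓛).level ⊥ r), σ⟧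
            (comm'' r)) (Φ'' r (𝐫⟦red'', T'', ((𝓛).level ⊥ r)⟧
              (c ⊥ ⟨r, fun _ hq => hPr'' (hr (Finset.mem_coe.2 hq))⟩)))) ∧
      ∀ d : Finset (HeightOneSpectrum (𝓞 ℚ)), (↑d : Set _) ⊆ D.primes → (↑d : Set _) ⊆ D''.primes →
        galoisCohomology.map π 1 (κ'' d) = κ d := by
  -- the two AUXILIARY coefficient systems `E[3^{k+N₀+1}]_{ℤ₃}`, `E[3^{m+N₀+1}]_{ℤ₃}` (GZ-2)
  letI := TorsionCoeff.torsionBy.padicIntModule 3 (k + N₀ + 1) (WeierstrassCurve.geomPoints W)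
  letI := TorsionCoeff.torsionBy.padicIntModule 3 (m + N₀ + 1) (WeierstrassCurve.geomPoints W)
  have hmk : ((3 : ℕ) : ℤ) ^ k * ((3 : ℕ) : ℤ) = ((3 ^ (k + 1) : ℕ) : ℤ) := by push_cast; ring
  have hmm : ((3 : ℕ) : ℤ) ^ m * ((3 : ℕ) : ℤ) = ((3 ^ (m + 1) : ℕ) : ℤ) := by push_cast; ring
  have hmk₂ : ((3 : ℕ) : ℤ) ^ (k + N₀) * ((3 : ℕ) : ℤ) = ((3 ^ (k + N₀ + 1) : ℕ) : ℤ) := by push_cast; ring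
  have hmm₂ : ((3 : ℕ) : ℤ) ^ (m + N₀) * ((3 : ℕ) : ℤ) = ((3 ^ (m + N₀ + 1) : ℕ) : ℤ) := by push_cast; ring
  -- Kolyvagin primes of the OUTPUT levels `k + 1`, `m + 1`
  have hKolk : ∀ ℓ ∈ D.primes, Kato.IsKolyvaginPrime W 3 (k + 1) ((primesEquiv ℓ : Nat.Primes) : ℕ) :=
    fun ℓ hℓ => (hKol ℓ hℓ).mono (by omega)
  have hKolm : ∀ ℓ ∈ D''.primes, Kato.IsKolyvaginPrime W 3 (m + 1) ((primesEquiv ℓ : Nat.Primes) : ℕ) :=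
    fun ℓ hℓ => (hKol'' ℓ hℓ).mono (by omega)
  -- the reductions `E[3^{k+N₀}·3] → E[3^k·3]`, `E[3^{m+N₀}·3] → E[3^m·3]` (T-DER-BP's `(r, hr)`)
  obtain ⟨rk, hrk⟩ := exists_torsionReduction_three W k (k + N₀)
  obtain ⟨rm, hrm⟩ := exists_torsionReduction_three W m (m + N₀)
  -- the pins in `tateToTorsion` form (T-DER-D4BN F1's `hcomp`)
  have hcompk : ∀ a : W.tateModule 3, tateToTorsion W 3 k a = e (red.hom a) := fun a =>
    Subtype.ext (by rw [coe_tateToTorsion_apply]; exact (hcomp a).symm)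
  have hcompm : ∀ a : W.tateModule 3, tateToTorsion W 3 m a = e'' (red''.hom a) := fun a =>
    Subtype.ext (by rw [coe_tateToTorsion_apply]; exact (hcomp'' a).symm)
  have hp2 : (3 : ℕ) ≠ 2 := by norm_num
  -- arithmetic Frobenii at every place; the Kolyvagin-prime data feeding THEOREM B-u at both depths
  have hFrex : ∀ ℓ : HeightOneSpectrum (𝓞 ℚ), ∃ Fr : absoluteGaloisGroup ℚ, IsArithFrobAtPlace ℚ ℓ Fr :=
    fun ℓ => (CyclotomicLevel.Rat.exists_isArithFrobAtPlace_mem_tameLevel 3 S ℓ).imp fun _ h => h.1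
  choose Fr hFr using hFrex
  have hramk : ∀ d : Finset (HeightOneSpectrum (𝓞 ℚ)), (↑d : Set _) ⊆ D.primes →
      ∀ ℓ ∈ d, ∀ s ⊆ d, ℓ ∉ s → ¬ SubgroupIsUnramifiedAt ℚ ((𝓛).level ⊥ (insert ℓ s)) ℓ :=
    fun d hd ℓ hℓ s _ _ =>
      CyclotomicLevel.Rat.not_subgroupIsUnramifiedAt_cyclotomicLevelsRat_level_insert 3 S ⊥
        (Derivative.Rat.ne_two_of_isKolyvaginPrime W 3 (Nat.succ_pos k)
          (hKolk ℓ (hd (Finset.mem_coe.2 hℓ)))) s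
  have hramm : ∀ d : Finset (HeightOneSpectrum (𝓞 ℚ)), (↑d : Set _) ⊆ D''.primes →
      ∀ ℓ ∈ d, ∀ s ⊆ d, ℓ ∉ s → ¬ SubgroupIsUnramifiedAt ℚ ((𝓛).level ⊥ (insert ℓ s)) ℓ :=
    fun d hd ℓ hℓ s _ _ =>
      CyclotomicLevel.Rat.not_subgroupIsUnramifiedAt_cyclotomicLevelsRat_level_insert 3 S ⊥
        (Derivative.Rat.ne_two_of_isKolyvaginPrime W 3 (Nat.succ_pos m)
          (hKolm ℓ (hd (Finset.mem_coe.2 hℓ)))) s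
  -- ONE generator family for both datums (D1 on `𝒫 ∪ 𝒫″`)
  obtain ⟨σ, hσI, hσχ, -, hσ⟩ := CyclotomicLevel.Rat.exists_sigma_mem_inertia_adicCompletionPrime 3 S η
    (D.primes ∪ D''.primes) (fun ℓ hℓ => hℓ.elim (fun h => hD.zpowers_eq_top h)
      (fun h => hD''.zpowers_eq_top h))
  have hσk : ∀ r : Finset (HeightOneSpectrum (𝓞 ℚ)), (↑r : Set _) ⊆ D.primes → _ :=
    fun r hr => hσ r (hr.trans Set.subset_union_left)
  have hσm : ∀ r : Finset (HeightOneSpectrum (𝓞 ℚ)), (↑r : Set _) ⊆ D''.primes → _ :=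
    fun r hr => hσ r (hr.trans Set.subset_union_right)
  -- `h0` at the four depths from `Irr(E[p])`
  have h0k : ∀ r : Finset (HeightOneSpectrum (𝓞 ℚ)), (↑r : Set _) ⊆ D.primes →
      ∀ P : WeierstrassCurve.geomTorsion W (((3 : ℕ) : ℤ) ^ k * ((3 : ℕ) : ℤ)),
        (∀ u : (𝓛).level ⊥ r, (u : absoluteGaloisGroup ℚ) • P = P) → P = 0 :=
    fun r _ P hP => geomTorsion_eq_zero_of_fixed_level W 3 S hp2 hirr hmk ⊥ r P hP
  have h0m : ∀ r : Finset (HeightOneSpectrum (𝓞 ℚ)), (↑r : Set _) ⊆ D''.primes →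
      ∀ P : WeierstrassCurve.geomTorsion W (((3 : ℕ) : ℤ) ^ m * ((3 : ℕ) : ℤ)),
        (∀ u : (𝓛).level ⊥ r, (u : absoluteGaloisGroup ℚ) • P = P) → P = 0 :=
    fun r _ P hP => geomTorsion_eq_zero_of_fixed_level W 3 S hp2 hirr hmm ⊥ r P hP
  have h0k₂ : ∀ r : Finset (HeightOneSpectrum (𝓞 ℚ)), (↑r : Set _) ⊆ D.primes →
      ∀ P : WeierstrassCurve.geomTorsion W (((3 : ℕ) : ℤ) ^ (k + N₀) * ((3 : ℕ) : ℤ)),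
        (∀ u : (𝓛).level ⊥ r, (u : absoluteGaloisGroup ℚ) • P = P) → P = 0 :=
    fun r _ P hP => geomTorsion_eq_zero_of_fixed_level W 3 S hp2 hirr hmk₂ ⊥ r P hP
  have h0m₂ : ∀ r : Finset (HeightOneSpectrum (𝓞 ℚ)), (↑r : Set _) ⊆ D''.primes →
      ∀ P : WeierstrassCurve.geomTorsion W (((3 : ℕ) : ℤ) ^ (m + N₀) * ((3 : ℕ) : ℤ)),
        (∀ u : (𝓛).level ⊥ r, (u : absoluteGaloisGroup ℚ) • P = P) → P = 0 :=
    fun r _ P hP => geomTorsion_eq_zero_of_fixed_level W 3 S hp2 hirr hmm₂ ⊥ r P hP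
  -- the two OUTPUT families (D2), same `σ`
  obtain ⟨Φ, comm, hΦ, κ, hκ0, hκ⟩ := exists_derivativeFamily W 3 S hc red (Nat.succ_pos k) hM e hec he
    einv hic h₁ h₂ D.primes hPr hKolk σ hσk h0k
  obtain ⟨Φ'', comm'', hΦ'', κ'', hκ0'', hκ''⟩ := exists_derivativeFamily W 3 S hc red'' (Nat.succ_pos m)
    hM'' e'' hec'' he'' einv'' hic'' h₁'' h₂'' D''.primes hPr'' hKolm σ hσm h0m
  -- the two AUXILIARY deeper families (depths `k + N₀` on `𝒫(D)`, `m + N₀` on `𝒫(D″)`), same `σ`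
  obtain ⟨Φ₂, comm₂, hΦ₂, κ₂, -, hκ₂⟩ := exists_derivativeFamily W 3 S hc 𝐫𝐞𝐝⟦k + N₀ + 1⟧
    (Nat.succ_pos (k + N₀)) (fun x => pow_smul_eq_zero 3 (k + N₀ + 1) _ x)
    (AddSubgroup.inclusion (geomTorsion_pow_succ_eq W 3 (k + N₀)).le : _ →+ _) continuous_of_discreteTopology
    (fun _ _ => rfl) (AddSubgroup.inclusion (geomTorsion_pow_succ_eq W 3 (k + N₀)).ge : _ →+ _)
    continuous_of_discreteTopology (fun x => Subtype.ext rfl) (fun y => Subtype.ext rfl)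
    D.primes hPr hKol σ hσk h0k₂
  obtain ⟨Φ₂'', comm₂'', hΦ₂'', κ₂'', -, hκ₂''⟩ := exists_derivativeFamily W 3 S hc 𝐫𝐞𝐝⟦m + N₀ + 1⟧
    (Nat.succ_pos (m + N₀)) (fun x => pow_smul_eq_zero 3 (m + N₀ + 1) _ x)
    (AddSubgroup.inclusion (geomTorsion_pow_succ_eq W 3 (m + N₀)).le : _ →+ _) continuous_of_discreteTopology
    (fun _ _ => rfl) (AddSubgroup.inclusion (geomTorsion_pow_succ_eq W 3 (m + N₀)).ge : _ →+ _)
    continuous_of_discreteTopology (fun x => Subtype.ext rfl) (fun y => Subtype.ext rfl)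
    D''.primes hPr'' hKol'' σ hσm h0m₂
  -- the global transports (GZ-1), for the pull-back of the classes to `T′`, `T″`
  obtain ⟨Φ₀, hΦ₀⟩ := exists_addEquiv_oneCocycleClass T'.toTopRep
    (W.torsionGaloisModule (((3 : ℕ) : ℤ) ^ k * ((3 : ℕ) : ℤ))).toTopRep e hec he einv hic h₁ h₂
  obtain ⟨Φ₀'', hΦ₀''⟩ := exists_addEquiv_oneCocycleClass T''.toTopRep
    (W.torsionGaloisModule (((3 : ℕ) : ℤ) ^ m * ((3 : ℕ) : ℤ))).toTopRep e'' hec'' he'' einv'' hic'' h₁'' h₂''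
  -- the unramified clause for `𝓕_can` at both depths (as in D4)
  have hunr : ∀ (j : ℕ) (w : HeightOneSpectrum (𝓞 ℚ)), W.HasGoodReductionAt w →
      ((primesEquiv w : Nat.Primes) : ℕ) ≠ 3 →
        unramifiedSubgroup (GaloisRep.toLocal w (W.torsionGaloisModule (((3 : ℕ) : ℤ) ^ j * ((3 : ℕ) : ℤ)))) 1 ≤
          propagatedSelmerStructure W 3 j (Sum.inr w) := fun j w hw hne =>
    (propagatedSelmerStructure_inr_eq_unramifiedSubgroup W 3 j
      (WeierstrassCurve.natCast_not_mem_asIdeal_of_primesEquiv_ne Fact.out hne) hw).ge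
  refine ⟨σ, Φ, comm, κ, Φ'', comm'', κ'', hσI, hσχ, hΦ, hΦ'', ?_, ?_, hκ0, hκ0'',
    fun r hr => (hκ r hr).1, fun r hr => (hκ'' r hr).1, fun d hdk hdm => ?_⟩
  · -- depth `k`: THEOREM D-core (D3b); the non-good places by the three-way split
    refine isKolyvaginSystem_derivativeFamily_of_transverse_eq W 3 S hp2 hc red hred (Nat.succ_pos k) hM
      hmk e hec he einv hic h₁ h₂ D hT hD hPr hKolk σ (fun ℓ _ => hσI ℓ) (fun ℓ _ => hσχ ℓ) hσk h0k Φ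
      hΦ comm κ hκ0 (fun r hr => (hκ r hr).1) _ (hunr k) fun d hd w hwd hw => ?_
    by_cases hwp : ((primesEquiv w : Nat.Primes) : ℕ) = 3
    · -- the place `3`: StableThree §1 with the AUXILIARY family of depth `k + N₀` (`hstab` at `w`)
      exact localization_mem_propagatedSelmerStructure_three_of_res_eq_deriv_of_stable
        W (W.continuous_galoisRepTate_holds 3) (hstab w hwp) (le_refl (k + N₀)) rk hrk ((𝓛).level ⊥ d) σ
        (fun ℓ => ((primesEquiv ℓ : Nat.Primes) : ℕ) - 1) d (comm₂ d) (comm d)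
        (c ⊥ ⟨d, fun _ hq => hPr (hd (Finset.mem_coe.2 hq))⟩)
        ((Φ₂ d).comp (𝐫⟦𝐫𝐞𝐝⟦k + N₀ + 1⟧, torsionRepPadicInt W 3 (k + N₀ + 1), ((𝓛).level ⊥ d)⟧).hom.toAddMonoidHom)
        (fun φ ψ hψ => comp_map_red_oneCocycleClass W 𝐫𝐞𝐝⟦k + N₀ + 1⟧
          (AddSubgroup.inclusion (geomTorsion_pow_succ_eq W 3 (k + N₀)).le : _ →+ _) (fun _ => rfl) _
          (Φ₂ d) (hΦ₂ d) φ ψ hψ)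
        ((Φ d).comp (𝐫⟦red, T', ((𝓛).level ⊥ d)⟧).hom.toAddMonoidHom)
        (fun φ ψ hψ => comp_map_red_oneCocycleClass W red e hcomp _ (Φ d) (hΦ d) φ ψ hψ)
        (κ₂ d) (hκ₂ d hd).1 ⟨κ d, (hκ d hd).1, fun κ₁ h => (hκ d hd).2 κ₁ h⟩ (κ d) (hκ d hd).1
    by_cases htors : ∀ P : (W.baseChange (w.adicCompletion ℚ)).toAffine.Point, (3 : ℕ) • P = 0 → P = 0
    · rw [propagatedSelmerStructure_inr_eq_top_of_torsion_eq_zero W 3 k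
        (WeierstrassCurve.natCast_not_mem_asIdeal_of_primesEquiv_ne Fact.out hwp) htors]
      exact AddSubgroup.mem_top _
    · -- ANOMALOUS bad `w`: THEOREM B-u road (no condition on the primes of `d`)
      have hκX := resSubgroup_symm_eq_noncommProd_deriv T'.toTopRep
        (W.torsionGaloisModule (((3 : ℕ) : ℤ) ^ k * ((3 : ℕ) : ℤ))).toTopRep e hec he einv h₁ h₂ ((𝓛).level ⊥ d)
        Φ₀ hΦ₀ (Φ d) (hΦ d) σ _ d
        (pairwise_commute_deriv (L := 𝓛) (T' := T') ⊥ d σ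
          (fun ℓ => ((primesEquiv ℓ : Nat.Primes) : ℕ) - 1)) (comm d) _ (κ d) ((hκ d hd).1)
      rw [← Φ₀.apply_symm_apply (κ d)]
      exact localization_mem_propagatedSelmerStructure_of_res_eq_deriv_of_unramified W k hc red e hec
        (fun g x => he g x) hcompk Φ₀.toAddMonoidHom (fun φ ψ h => hΦ₀ φ ψ h)
        ⟨d, fun _ hq => hPr (hd (Finset.mem_coe.2 hq))⟩ σ Fr (hσk d hd).1 (hσk d hd).2.1 (hσk d hd).2.2
        (fun ℓ _ => hFr ℓ) (hramk d hd)
        (fun ℓ hℓ v => natCast_sub_one_smul_eq_zero_of_isKolyvaginPrime W 3 k hM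
          (hKolk ℓ (hd (Finset.mem_coe.2 hℓ))) v)
        (fun ℓ hℓ v => eval_one_rubinEulerFactor_smul_eq_zero_of_isKolyvaginPrime W 3 k hM
          (hKolk ℓ (hd (Finset.mem_coe.2 hℓ))) (hFr ℓ) v)
        _ (eq_zero_of_forall_level_fixed_of_equiv W 3 k e he einv h₁ ((𝓛).level ⊥ d) (h0k d hd))
        (Φ₀.symm (κ d)) hκX w hwd
        (fun s hs 𝔓 h𝔓 => hur ⊥ ⟨s, fun _ hq => hPr (hd (Finset.mem_coe.2 (hs hq)))⟩ w hwp 𝔓 h𝔓)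
  · -- depth `m`: the same
    refine isKolyvaginSystem_derivativeFamily_of_transverse_eq W 3 S hp2 hc red'' hred'' (Nat.succ_pos m)
      hM'' hmm e'' hec'' he'' einv'' hic'' h₁'' h₂'' D'' hT'' hD'' hPr'' hKolm σ (fun ℓ _ => hσI ℓ)
      (fun ℓ _ => hσχ ℓ) hσm h0m Φ'' hΦ'' comm'' κ'' hκ0'' (fun r hr => (hκ'' r hr).1) _ (hunr m)
      fun d hd w hwd hw => ?_
    by_cases hwp : ((primesEquiv w : Nat.Primes) : ℕ) = 3
    · -- the place `3`: StableThree §1 with the AUXILIARY family of depth `m + N₀`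
      exact localization_mem_propagatedSelmerStructure_three_of_res_eq_deriv_of_stable
        W (W.continuous_galoisRepTate_holds 3) (hstab w hwp) (le_refl (m + N₀)) rm hrm ((𝓛).level ⊥ d) σ
        (fun ℓ => ((primesEquiv ℓ : Nat.Primes) : ℕ) - 1) d (comm₂'' d) (comm'' d)
        (c ⊥ ⟨d, fun _ hq => hPr'' (hd (Finset.mem_coe.2 hq))⟩)
        ((Φ₂'' d).comp (𝐫⟦𝐫𝐞𝐝⟦m + N₀ + 1⟧, torsionRepPadicInt W 3 (m + N₀ + 1), ((𝓛).level ⊥ d)⟧).hom.toAddMonoidHom)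
        (fun φ ψ hψ => comp_map_red_oneCocycleClass W 𝐫𝐞𝐝⟦m + N₀ + 1⟧
          (AddSubgroup.inclusion (geomTorsion_pow_succ_eq W 3 (m + N₀)).le : _ →+ _) (fun _ => rfl) _
          (Φ₂'' d) (hΦ₂'' d) φ ψ hψ)
        ((Φ'' d).comp (𝐫⟦red'', T'', ((𝓛).level ⊥ d)⟧).hom.toAddMonoidHom)
        (fun φ ψ hψ => comp_map_red_oneCocycleClass W red'' e'' hcomp'' _ (Φ'' d) (hΦ'' d) φ ψ hψ)
        (κ₂'' d) (hκ₂'' d hd).1 ⟨κ'' d, (hκ'' d hd).1, fun κ₁ h => (hκ'' d hd).2 κ₁ h⟩ (κ'' d) (hκ'' d hd).1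
    by_cases htors : ∀ P : (W.baseChange (w.adicCompletion ℚ)).toAffine.Point, (3 : ℕ) • P = 0 → P = 0
    · rw [propagatedSelmerStructure_inr_eq_top_of_torsion_eq_zero W 3 m
        (WeierstrassCurve.natCast_not_mem_asIdeal_of_primesEquiv_ne Fact.out hwp) htors]
      exact AddSubgroup.mem_top _
    · -- ANOMALOUS bad `w`: THEOREM B-u road at depth `m`
      have hκX := resSubgroup_symm_eq_noncommProd_deriv T''.toTopRep
        (W.torsionGaloisModule (((3 : ℕ) : ℤ) ^ m * ((3 : ℕ) : ℤ))).toTopRep e'' hec'' he'' einv'' h₁'' h₂''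
        ((𝓛).level ⊥ d) Φ₀'' hΦ₀'' (Φ'' d) (hΦ'' d) σ _ d
        (pairwise_commute_deriv (L := 𝓛) (T' := T'') ⊥ d σ
          (fun ℓ => ((primesEquiv ℓ : Nat.Primes) : ℕ) - 1)) (comm'' d) _ (κ'' d) ((hκ'' d hd).1)
      rw [← Φ₀''.apply_symm_apply (κ'' d)]
      exact localization_mem_propagatedSelmerStructure_of_res_eq_deriv_of_unramified W m hc red'' e'' hec''
        (fun g x => he'' g x) hcompm Φ₀''.toAddMonoidHom (fun φ ψ h => hΦ₀'' φ ψ h)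
        ⟨d, fun _ hq => hPr'' (hd (Finset.mem_coe.2 hq))⟩ σ Fr (hσm d hd).1 (hσm d hd).2.1 (hσm d hd).2.2
        (fun ℓ _ => hFr ℓ) (hramm d hd)
        (fun ℓ hℓ v => natCast_sub_one_smul_eq_zero_of_isKolyvaginPrime W 3 m hM''
          (hKolm ℓ (hd (Finset.mem_coe.2 hℓ))) v)
        (fun ℓ hℓ v => eval_one_rubinEulerFactor_smul_eq_zero_of_isKolyvaginPrime W 3 m hM''
          (hKolm ℓ (hd (Finset.mem_coe.2 hℓ))) (hFr ℓ) v)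
        _ (eq_zero_of_forall_level_fixed_of_equiv W 3 m e'' he'' einv'' h₁'' ((𝓛).level ⊥ d) (h0m d hd))
        (Φ₀''.symm (κ'' d)) hκX w hwd
        (fun s hs 𝔓 h𝔓 => hur ⊥ ⟨s, fun _ hq => hPr'' (hd (Finset.mem_coe.2 (hs hq)))⟩ w hwp 𝔓 h𝔓)
  · -- (COMP) on the common levels
    exact map_derivativeFamily_eq W 3 S hkm red e hcomp red'' e'' hcomp'' π hπ (D.primes ∩ D''.primes)
      (fun ℓ hℓ => hPr hℓ.1) σ Φ hΦ comm κ (fun r hr => hκ r (hr.trans Set.inter_subset_left)) Φ'' hΦ''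
      comm'' κ'' (fun r hr => (hκ'' r (hr.trans Set.inter_subset_right)).1) d
      (Set.subset_inter hdk hdm)

end Summit.BirchSwinnertonDyer.BirchSwinnertonDyer.Theorems.KimAtThreeDeepLowerKolyvaginPairStable

end
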